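import Mathlib

/-!
# Hodge locus census, cell V3-XT, `N = 1`, `α₀`-row — THEOREM QC: the valuation-theoretic kernel

HONEST FRAMING: certified instances and evidence bearing on the general Hodge conjecture; no claim.
This file is a HELPER for the engine-B census of the `α₀`-row (`α₀ = θ(θ − 1728)`, `θ = j(O_D)`) of the
Hodge-locus programme (`stmt-HodgeConjecture-16267`); it proves no statement about Hodge classes.

THEOREM QC (engine B, abs-2 gen 24; derivation note `DERIVATION-QC.md`): let `D = D₀ f²`, `l ∈ {2, 3}`,
`l ∣ f`, `k = v_l(f) ≥ 1`, `l` inert or ramified in `K = ℚ(√D₀)`.  Then EVERY root `θ` of the class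
polynomial `H_D` in an algebraic closure of `ℚ_l` has
`v_l(θ) = v_l(θ − 1728) = 2^(3−k)` (2 inert), `3·2^(1−k)` (2 ramified), `(3/2)·3^(1−k)` (3 inert),
`3^(1−k)` (3 ramified)  (`v_l` normalised by `v_l(l) = 1`).
The proof climbs the `l`-isogeny volcano: `Φ_l(θ_k, θ_{k−1}) = 0` (modular equation), one root of
`Φ_l(X, θ_{k−1})` is known (one level down, or horizontal at a ramified crater) and the remaining `l`
roots are controlled by the two STEP LEMMAS below; the craters are the laws L2 / R2 / L3 / R3 of the
census (§14 of DERIVATIONS_engineB.md) and the BASE LEMMAS below (all roots of a cubic / quartic).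

What is kernel-checked here, for an ARBITRARY valuation `v : K → Γ₀` (Mathlib's multiplicative
convention: `v x ≤ g` means "at least as divisible as `g`"):
* `root_le_two/three/four` — a root `r` of a monic polynomial whose `j`-th coefficient from the top has
  valuation `≤ c^j` satisfies `v r ≤ c` (the dominant-term argument);
* `all_eq_two/three/four` — if moreover the constant coefficient has valuation exactly `c^n`, every
  root has valuation exactly `c` (single-segment Newton polygon), in Vieta form;
* `step_two` — `Φ₂`-step: for a monic cubic with roots `r₀, r₁, r₂`, if `v c₂ ≤ h`, `v c₁ = h²` and the
  known root has `v r₀ < h` (strictly more divisible), then `v r₁ = v r₂ = h`;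
* `step_three` — `Φ₃`-step: for a monic quartic with roots `r₀, r₁, r₂, r₃`, if `v c₃ ≤ t`, `v c₂ ≤ t²`,
  `v c₁ = t³` and `v r₀ < t`, then `v r₁ = v r₂ = v r₃ = t`;
* the integer facts feeding the hypotheses: Smith's 1878 form of `Φ₃` [Cox, Primes of the form x²+ny²,
  (11.22)] expands to the coefficient list used by the census code, the shifted polynomial
  `Ψ₃(X, Y) = Φ₃(X + 1728, Y + 1728)` has the stated coefficients, and the `2`- and `3`-adic
  valuations of the coefficients of `Φ₂` and `Ψ₃` are as tabulated in the derivation note.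
-/

set_option linter.dupNamespace false

namespace Summit.HodgeConjecture.HodgeConjecture.HodgeLocus.Census.TheoremQC

section Valued

variable {K : Type*} [Field K] {Γ₀ : Type*} [LinearOrderedCommGroupWithZero Γ₀] (v : Valuation K Γ₀)

/-- strict monotonicity helper in the value group. -/
theorem mul_lt_mul_of_lt_of_le' {a b e d : Γ₀} (hab : a < b) (hed : e ≤ d) (hb : b ≠ 0) (hd : d ≠ 0) :
    a * e < b * d := by
  by_cases he : e = 0
  · subst he; rw [mul_zero]; exact zero_lt_iff.mpr (mul_ne_zero hb hd)
  · calc a * e < b * e := mul_lt_mul_of_pos_right hab (zero_lt_iff.mpr he)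
      _ ≤ b * d := mul_le_mul' le_rfl hed

/-- Dominant term, degree 2: a root of `X² + a₁X + a₀` with `v a₁ ≤ c`, `v a₀ ≤ c²` has `v r ≤ c`. -/
theorem root_le_two {r a₁ a₀ : K} {c : Γ₀} (hr : r * r + a₁ * r + a₀ = 0)
    (h₁ : v a₁ ≤ c) (h₀ : v a₀ ≤ c * c) : v r ≤ c := by
  by_contra hnot
  have hlt : c < v r := not_le.mp hnot
  have hr0 : v r ≠ 0 := ne_of_gt (lt_of_le_of_lt zero_le hlt)
  have hc_lt : c * v r < v r * v r := mul_lt_mul_of_pos_right hlt (zero_lt_iff.mpr hr0)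
  have t1 : v (a₁ * r) < v r * v r := by
    rw [map_mul]; exact lt_of_le_of_lt (mul_le_mul' h₁ le_rfl) hc_lt
  have t0 : v a₀ < v r * v r := by
    refine lt_of_le_of_lt h₀ ?_
    by_cases hc : c = 0
    · subst hc; rw [zero_mul]; exact zero_lt_iff.mpr (mul_ne_zero hr0 hr0)
    · exact lt_trans (mul_lt_mul_of_pos_left hlt (zero_lt_iff.mpr hc)) hc_lt
  have hsum : v (a₁ * r + a₀) < v r * v r := Valuation.map_add_lt v t1 t0
  have hid : r * r = -(a₁ * r + a₀) := by linear_combination hr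
  have : v (r * r) = v (a₁ * r + a₀) := by rw [hid, Valuation.map_neg]
  rw [map_mul] at this
  exact absurd this (ne_of_gt hsum)

/-- Dominant term, degree 3. -/
theorem root_le_three {r a₂ a₁ a₀ : K} {c : Γ₀} (hr : r * r * r + a₂ * (r * r) + a₁ * r + a₀ = 0)
    (h₂ : v a₂ ≤ c) (h₁ : v a₁ ≤ c * c) (h₀ : v a₀ ≤ c * c * c) : v r ≤ c := by
  by_contra hnot
  have hlt : c < v r := not_le.mp hnot
  have hr0 : v r ≠ 0 := ne_of_gt (lt_of_le_of_lt zero_le hlt)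
  have hrp : 0 < v r := zero_lt_iff.mpr hr0
  -- c^j * (v r)^(3-j) < (v r)^3 for j = 1, 2, 3
  have e1 : c * (v r * v r) < v r * (v r * v r) :=
    mul_lt_mul_of_pos_right hlt (zero_lt_iff.mpr (mul_ne_zero hr0 hr0))
  have e2 : c * c * v r < v r * (v r * v r) := by
    by_cases hc : c = 0
    · subst hc; rw [zero_mul, zero_mul]; exact zero_lt_iff.mpr (mul_ne_zero hr0 (mul_ne_zero hr0 hr0))
    · have : c * c * v r ≤ c * (v r * v r) := by
        rw [mul_assoc]; exact mul_le_mul' le_rfl (mul_le_mul' (le_of_lt hlt) le_rfl)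
      exact lt_of_le_of_lt this e1
  have e3 : c * c * c < v r * (v r * v r) := by
    by_cases hc : c = 0
    · subst hc; rw [zero_mul, zero_mul]; exact zero_lt_iff.mpr (mul_ne_zero hr0 (mul_ne_zero hr0 hr0))
    · have : c * c * c ≤ c * c * v r := mul_le_mul' le_rfl (le_of_lt hlt)
      exact lt_of_le_of_lt this e2
  have t2 : v (a₂ * (r * r)) < v r * (v r * v r) := by
    rw [map_mul, map_mul]; exact lt_of_le_of_lt (mul_le_mul' h₂ le_rfl) e1
  have t1 : v (a₁ * r) < v r * (v r * v r) := by
    rw [map_mul]; exact lt_of_le_of_lt (mul_le_mul' h₁ le_rfl) e2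
  have t0 : v a₀ < v r * (v r * v r) := lt_of_le_of_lt h₀ e3
  have hsum : v (a₂ * (r * r) + a₁ * r + a₀) < v r * (v r * v r) :=
    Valuation.map_add_lt v (Valuation.map_add_lt v t2 t1) t0
  have hid : r * r * r = -(a₂ * (r * r) + a₁ * r + a₀) := by linear_combination hr
  have : v (r * r * r) = v (a₂ * (r * r) + a₁ * r + a₀) := by rw [hid, Valuation.map_neg]
  rw [map_mul, map_mul, mul_assoc] at this
  exact absurd this (ne_of_gt hsum)

/-- Dominant term, degree 4. -/
theorem root_le_four {r a₃ a₂ a₁ a₀ : K} {c : Γ₀}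
    (hr : r * r * r * r + a₃ * (r * r * r) + a₂ * (r * r) + a₁ * r + a₀ = 0)
    (h₃ : v a₃ ≤ c) (h₂ : v a₂ ≤ c * c) (h₁ : v a₁ ≤ c * c * c) (h₀ : v a₀ ≤ c * c * c * c) :
    v r ≤ c := by
  by_contra hnot
  have hlt : c < v r := not_le.mp hnot
  have hr0 : v r ≠ 0 := ne_of_gt (lt_of_le_of_lt zero_le hlt)
  set x := v r with hx
  have hx2 : x * x ≠ 0 := mul_ne_zero hr0 hr0
  have hx3 : x * x * x ≠ 0 := mul_ne_zero hx2 hr0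
  have e1 : c * (x * x * x) < x * (x * x * x) := mul_lt_mul_of_pos_right hlt (zero_lt_iff.mpr hx3)
  have cle : c ≤ x := le_of_lt hlt
  have e2 : c * c * (x * x) < x * (x * x * x) := by
    have : c * c * (x * x) ≤ c * (x * x * x) := by
      have h' : c * (x * x) ≤ x * (x * x) := mul_le_mul' cle le_rfl
      calc c * c * (x * x) = c * (c * (x * x)) := by simp only [mul_assoc]
        _ ≤ c * (x * (x * x)) := mul_le_mul' le_rfl h'
        _ = c * (x * x * x) := by simp only [mul_assoc]
    exact lt_of_le_of_lt this e1
  have e3 : c * c * c * x < x * (x * x * x) := by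
    have : c * c * c * x ≤ c * c * (x * x) := by
      calc c * c * c * x = c * c * (c * x) := by simp only [mul_assoc]
        _ ≤ c * c * (x * x) := mul_le_mul' le_rfl (mul_le_mul' cle le_rfl)
    exact lt_of_le_of_lt this e2
  have e4 : c * c * c * c < x * (x * x * x) := by
    have : c * c * c * c ≤ c * c * c * x := mul_le_mul' le_rfl cle
    exact lt_of_le_of_lt this e3
  have t3 : v (a₃ * (r * r * r)) < x * (x * x * x) := by
    rw [map_mul, map_mul, map_mul]; exact lt_of_le_of_lt (mul_le_mul' h₃ le_rfl) e1
  have t2 : v (a₂ * (r * r)) < x * (x * x * x) := by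
    rw [map_mul, map_mul]; exact lt_of_le_of_lt (mul_le_mul' h₂ le_rfl) e2
  have t1 : v (a₁ * r) < x * (x * x * x) := by
    rw [map_mul]; exact lt_of_le_of_lt (mul_le_mul' h₁ le_rfl) e3
  have t0 : v a₀ < x * (x * x * x) := lt_of_le_of_lt h₀ e4
  have hsum : v (a₃ * (r * r * r) + a₂ * (r * r) + a₁ * r + a₀) < x * (x * x * x) :=
    Valuation.map_add_lt v (Valuation.map_add_lt v (Valuation.map_add_lt v t3 t2) t1) t0
  have hid : r * r * r * r = -(a₃ * (r * r * r) + a₂ * (r * r) + a₁ * r + a₀) := by linear_combination hr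
  have : v (r * r * r * r) = v (a₃ * (r * r * r) + a₂ * (r * r) + a₁ * r + a₀) := by
    rw [hid, Valuation.map_neg]
  rw [map_mul, map_mul, map_mul] at this
  have hx4 : v r * v r * v r * v r = x * (x * x * x) := by simp only [hx, mul_assoc]
  rw [hx4] at this
  exact absurd this (ne_of_gt hsum)

/-- If two values are `≤ c` and their product is `c²` (`c ≠ 0`), both equal `c`. -/
theorem eq_of_le_of_mul_eq_two {x y c : Γ₀} (hc : c ≠ 0) (hx : x ≤ c) (hy : y ≤ c)
    (hp : x * y = c * c) : x = c ∧ y = c := by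
  have hx' : x = c := by
    by_contra hne
    have := mul_lt_mul_of_lt_of_le' (lt_of_le_of_ne hx hne) hy hc hc
    exact absurd hp (ne_of_lt this)
  subst hx'
  exact ⟨rfl, mul_left_cancel₀ hc hp⟩

/-- Three values `≤ c` with product `c³` (`c ≠ 0`) all equal `c`. -/
theorem eq_of_le_of_mul_eq_three {x y z c : Γ₀} (hc : c ≠ 0) (hx : x ≤ c) (hy : y ≤ c) (hz : z ≤ c)
    (hp : x * y * z = c * c * c) : x = c ∧ y = c ∧ z = c := by
  have hcc : c * c ≠ 0 := mul_ne_zero hc hc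
  have hxy : x * y ≤ c * c := mul_le_mul' hx hy
  have hxy' : x * y = c * c := by
    by_contra hne
    have := mul_lt_mul_of_lt_of_le' (lt_of_le_of_ne hxy hne) hz hcc hc
    exact absurd hp (ne_of_lt this)
  have hz' : z = c := by
    rw [hxy'] at hp; exact mul_left_cancel₀ hcc hp
  obtain ⟨h1, h2⟩ := eq_of_le_of_mul_eq_two hc hx hy hxy'
  exact ⟨h1, h2, hz'⟩

/-- Four values `≤ c` with product `c⁴` (`c ≠ 0`) all equal `c`. -/
theorem eq_of_le_of_mul_eq_four {x y z w c : Γ₀} (hc : c ≠ 0) (hx : x ≤ c) (hy : y ≤ c) (hz : z ≤ c)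
    (hw : w ≤ c) (hp : x * y * z * w = c * c * c * c) : x = c ∧ y = c ∧ z = c ∧ w = c := by
  have hccc : c * c * c ≠ 0 := mul_ne_zero (mul_ne_zero hc hc) hc
  have hxyz : x * y * z ≤ c * c * c := mul_le_mul' (mul_le_mul' hx hy) hz
  have hxyz' : x * y * z = c * c * c := by
    by_contra hne
    have := mul_lt_mul_of_lt_of_le' (lt_of_le_of_ne hxyz hne) hw hccc hc
    exact absurd hp (ne_of_lt this)
  have hw' : w = c := by
    rw [hxyz'] at hp; exact mul_left_cancel₀ hccc hp
  obtain ⟨h1, h2, h3⟩ := eq_of_le_of_mul_eq_three hc hx hy hz hxyz'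
  exact ⟨h1, h2, h3, hw'⟩

/-- BASE LEMMA, degree 2 (Vieta form): `v (r₁ + r₂) ≤ c`, `v (r₁ r₂) = c²`, `c ≠ 0` ⟹ `v r₁ = v r₂ = c`. -/
theorem all_eq_two {r₁ r₂ : K} {c : Γ₀} (hc : c ≠ 0)
    (h₁ : v (r₁ + r₂) ≤ c) (h₀ : v (r₁ * r₂) = c * c) : v r₁ = c ∧ v r₂ = c := by
  -- each rᵢ is a root of X² − (r₁+r₂) X + r₁ r₂
  have b : ∀ r : K, r * r + (-(r₁ + r₂)) * r + r₁ * r₂ = 0 → v r ≤ c := fun r hr =>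
    root_le_two v hr (by rw [Valuation.map_neg]; exact h₁) (le_of_eq h₀)
  have hb₁ := b r₁ (by ring)
  have hb₂ := b r₂ (by ring)
  have hp : v r₁ * v r₂ = c * c := by rw [← map_mul]; exact h₀
  exact eq_of_le_of_mul_eq_two hc hb₁ hb₂ hp

/-- BASE LEMMA, degree 3 (Vieta form; used for the three roots of `Φ₂(X, θ₀)` at an inert `2`). -/
theorem all_eq_three {r₁ r₂ r₃ : K} {c : Γ₀} (hc : c ≠ 0)
    (h₁ : v (r₁ + r₂ + r₃) ≤ c) (h₂ : v (r₁ * r₂ + r₁ * r₃ + r₂ * r₃) ≤ c * c)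
    (h₃ : v (r₁ * r₂ * r₃) = c * c * c) : v r₁ = c ∧ v r₂ = c ∧ v r₃ = c := by
  have b : ∀ r : K, r * r * r + (-(r₁ + r₂ + r₃)) * (r * r) + (r₁ * r₂ + r₁ * r₃ + r₂ * r₃) * r
      + (-(r₁ * r₂ * r₃)) = 0 → v r ≤ c := fun r hr =>
    root_le_three v hr (by rw [Valuation.map_neg]; exact h₁) h₂ (by rw [Valuation.map_neg]; exact le_of_eq h₃)
  have hb₁ := b r₁ (by ring)
  have hb₂ := b r₂ (by ring)
  have hb₃ := b r₃ (by ring)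
  have hp : v r₁ * v r₂ * v r₃ = c * c * c := by rw [← map_mul, ← map_mul]; exact h₃
  exact eq_of_le_of_mul_eq_three hc hb₁ hb₂ hb₃ hp

/-- BASE LEMMA, degree 4 (Vieta form; used for the four roots of `Φ₃(X, θ₀)` at an inert `3`). -/
theorem all_eq_four {r₁ r₂ r₃ r₄ : K} {c : Γ₀} (hc : c ≠ 0)
    (h₁ : v (r₁ + r₂ + r₃ + r₄) ≤ c)
    (h₂ : v (r₁ * r₂ + r₁ * r₃ + r₁ * r₄ + r₂ * r₃ + r₂ * r₄ + r₃ * r₄) ≤ c * c)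
    (h₃ : v (r₁ * r₂ * r₃ + r₁ * r₂ * r₄ + r₁ * r₃ * r₄ + r₂ * r₃ * r₄) ≤ c * c * c)
    (h₄ : v (r₁ * r₂ * r₃ * r₄) = c * c * c * c) :
    v r₁ = c ∧ v r₂ = c ∧ v r₃ = c ∧ v r₄ = c := by
  have b : ∀ r : K, r * r * r * r + (-(r₁ + r₂ + r₃ + r₄)) * (r * r * r)
      + (r₁ * r₂ + r₁ * r₃ + r₁ * r₄ + r₂ * r₃ + r₂ * r₄ + r₃ * r₄) * (r * r)
      + (-(r₁ * r₂ * r₃ + r₁ * r₂ * r₄ + r₁ * r₃ * r₄ + r₂ * r₃ * r₄)) * r + r₁ * r₂ * r₃ * r₄ = 0 →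
      v r ≤ c := fun r hr =>
    root_le_four v hr (by rw [Valuation.map_neg]; exact h₁) h₂ (by rw [Valuation.map_neg]; exact h₃) (le_of_eq h₄)
  have hb₁ := b r₁ (by ring)
  have hb₂ := b r₂ (by ring)
  have hb₃ := b r₃ (by ring)
  have hb₄ := b r₄ (by ring)
  have hp : v r₁ * v r₂ * v r₃ * v r₄ = c * c * c * c := by rw [← map_mul, ← map_mul, ← map_mul]; exact h₄
  exact eq_of_le_of_mul_eq_four hc hb₁ hb₂ hb₃ hb₄ hp

/-- STEP LEMMA for `Φ₂` (one known root split off a monic cubic).  Roots `r₀, r₁, r₂`; coefficients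
`c₂ = −(r₀ + r₁ + r₂)`, `c₁ = r₀r₁ + r₀r₂ + r₁r₂`.  If `v c₂ ≤ h`, `v c₁ = h²` and `v r₀ < h` (the known
root is STRICTLY more divisible than the target), then `v r₁ = v r₂ = h`.  (`c₀` is not needed.) -/
theorem step_two {r₀ r₁ r₂ c₂ c₁ : K} {h : Γ₀} (hh : h ≠ 0)
    (hc₂ : c₂ = -(r₀ + r₁ + r₂)) (hc₁ : c₁ = r₀ * r₁ + r₀ * r₂ + r₁ * r₂)
    (hv₂ : v c₂ ≤ h) (hv₁ : v c₁ = h * h) (hr₀ : v r₀ < h) : v r₁ = h ∧ v r₂ = h := by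
  -- s₁ = r₁ + r₂ = −c₂ − r₀ ;  s₂ = r₁ r₂ = c₁ − r₀ s₁
  have hs₁ : r₁ + r₂ = -c₂ + -r₀ := by rw [hc₂]; ring
  have vs₁ : v (r₁ + r₂) ≤ h := by
    rw [hs₁]
    refine Valuation.map_add_le v ?_ ?_
    · rw [Valuation.map_neg]; exact hv₂
    · rw [Valuation.map_neg]; exact le_of_lt hr₀
  have hs₂ : r₁ * r₂ = c₁ - r₀ * (r₁ + r₂) := by rw [hc₁]; ring
  have vlow : v (r₀ * (r₁ + r₂)) < v c₁ := by
    rw [map_mul, hv₁]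
    exact mul_lt_mul_of_lt_of_le' hr₀ vs₁ hh hh
  have vs₂ : v (r₁ * r₂) = h * h := by
    rw [hs₂, Valuation.map_sub_eq_of_lt_left v vlow, hv₁]
  exact all_eq_two v hh vs₁ vs₂

/-- STEP LEMMA for `Φ₃` (one known root split off a monic quartic).  Roots `r₀, r₁, r₂, r₃`;
`c₃ = −(r₀ + s₁)`, `c₂ = r₀ s₁ + s₂`, `c₁ = −(r₀ s₂ + s₃)` with `s₁, s₂, s₃` the elementary symmetric
functions of `r₁, r₂, r₃`.  If `v c₃ ≤ t`, `v c₂ ≤ t²`, `v c₁ = t³` and `v r₀ < t`, then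
`v r₁ = v r₂ = v r₃ = t`.  (`c₀` is not needed.) -/
theorem step_three {r₀ r₁ r₂ r₃ c₃ c₂ c₁ : K} {t : Γ₀} (ht : t ≠ 0)
    (hc₃ : c₃ = -(r₀ + r₁ + r₂ + r₃))
    (hc₂ : c₂ = r₀ * r₁ + r₀ * r₂ + r₀ * r₃ + r₁ * r₂ + r₁ * r₃ + r₂ * r₃)
    (hc₁ : c₁ = -(r₀ * r₁ * r₂ + r₀ * r₁ * r₃ + r₀ * r₂ * r₃ + r₁ * r₂ * r₃))
    (hv₃ : v c₃ ≤ t) (hv₂ : v c₂ ≤ t * t) (hv₁ : v c₁ = t * t * t) (hr₀ : v r₀ < t) :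
    v r₁ = t ∧ v r₂ = t ∧ v r₃ = t := by
  have htt : t * t ≠ 0 := mul_ne_zero ht ht
  -- s₁ = −c₃ − r₀
  have hs₁ : r₁ + r₂ + r₃ = -c₃ + -r₀ := by rw [hc₃]; ring
  have vs₁ : v (r₁ + r₂ + r₃) ≤ t := by
    rw [hs₁]
    refine Valuation.map_add_le v ?_ ?_
    · rw [Valuation.map_neg]; exact hv₃
    · rw [Valuation.map_neg]; exact le_of_lt hr₀
  -- s₂ = c₂ − r₀ s₁
  have hs₂ : r₁ * r₂ + r₁ * r₃ + r₂ * r₃ = c₂ + -(r₀ * (r₁ + r₂ + r₃)) := by rw [hc₂]; ring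
  have vs₂ : v (r₁ * r₂ + r₁ * r₃ + r₂ * r₃) ≤ t * t := by
    rw [hs₂]
    refine Valuation.map_add_le v hv₂ ?_
    rw [Valuation.map_neg, map_mul]
    exact mul_le_mul' (le_of_lt hr₀) vs₁
  -- s₃ = −c₁ − r₀ s₂, and v (r₀ s₂) < t³ = v c₁
  have hs₃ : r₁ * r₂ * r₃ = -c₁ - r₀ * (r₁ * r₂ + r₁ * r₃ + r₂ * r₃) := by rw [hc₁]; ring
  have vlow : v (r₀ * (r₁ * r₂ + r₁ * r₃ + r₂ * r₃)) < v (-c₁) := by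
    rw [map_mul, Valuation.map_neg, hv₁]
    have : v r₀ * v (r₁ * r₂ + r₁ * r₃ + r₂ * r₃) < t * (t * t) :=
      mul_lt_mul_of_lt_of_le' hr₀ vs₂ ht htt
    calc v r₀ * v (r₁ * r₂ + r₁ * r₃ + r₂ * r₃) < t * (t * t) := this
      _ = t * t * t := by simp only [mul_assoc]
  have vs₃ : v (r₁ * r₂ * r₃) = t * t * t := by
    rw [hs₃, Valuation.map_sub_eq_of_lt_left v vlow, Valuation.map_neg, hv₁]
  exact all_eq_three v ht vs₁ vs₂ vs₃

end Valued

/-! ## Integer facts: the modular polynomials `Φ₂`, `Φ₃`, the shift `Ψ₃`, coefficient valuations -/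

section IntegerFacts

/-! No definitions are introduced (the tree keeps `Theorems/` definition-free): `Φ₂`, `Φ₃` enter each
statement as an arbitrary function `P : ℤ → ℤ → ℤ` together with the hypothesis that it is given by the explicit
symmetric form below (the coefficient lists of the census code = PARI `polmodular(2)`, `polmodular(3)`). -/

/-- Smith's 1878 factored form of `Φ₃` [Cox, *Primes of the form x² + ny²*, (11.22)] equals the symmetric
coefficient form used by the census: a second, printed source for the coefficient list. -/
theorem Phi3_eq_smith (x y : ℤ) :
    x ^ 4 + y ^ 4 - x ^ 3 * y ^ 3 + 2232 * (x ^ 3 * y ^ 2 + x ^ 2 * y ^ 3)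
        - 1069956 * (x ^ 3 * y + x * y ^ 3) + 36864000 * (x ^ 3 + y ^ 3)
        + 2587918086 * x ^ 2 * y ^ 2 + 8900222976000 * (x ^ 2 * y + x * y ^ 2)
        + 452984832000000 * (x ^ 2 + y ^ 2) - 770845966336000000 * x * y
        + 1855425871872000000000 * (x + y)
      = x * (x + 2 ^ 15 * 3 * 5 ^ 3) ^ 3 + y * (y + 2 ^ 15 * 3 * 5 ^ 3) ^ 3
      + 2 ^ 3 * 3 ^ 2 * 31 * x ^ 2 * y ^ 2 * (x + y) - x ^ 3 * y ^ 3
      - 2 ^ 2 * 3 ^ 3 * 9907 * x * y * (x ^ 2 + y ^ 2) + 2 * 3 ^ 4 * 13 * 193 * 6367 * x ^ 2 * y ^ 2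
      + 2 ^ 16 * 3 ^ 5 * 5 ^ 3 * 17 * 263 * x * y * (x + y) - 2 ^ 31 * 5 ^ 6 * 22973 * x * y := by
  ring

/-- CM sanity values (level 2): `j = 1728, 8000, −3375` are `2`-isogenous to themselves resp. to
`287496 = j(ℤ[2i])`, `16581375 = j(ℤ[(1+√−7)/2 · 2])`, and `Φ₂(0, 54000) = 0` (`54000 = j(ℤ[√−3])`). -/
theorem Phi2_cm_values (P : ℤ → ℤ → ℤ)
    (hP : ∀ x y, P x y = x ^ 3 + y ^ 3 - x ^ 2 * y ^ 2 + 1488 * (x ^ 2 * y + x * y ^ 2) - 162000 * (x ^ 2 + y ^ 2)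
        + 40773375 * x * y + 8748000000 * (x + y) - 157464000000000) :
    P 1728 1728 = 0 ∧ P 8000 8000 = 0 ∧ P (-3375) (-3375) = 0 ∧ P 1728 287496 = 0 ∧
    P (-3375) 16581375 = 0 ∧ P 0 54000 = 0 := by
  simp only [hP]; norm_num

/-- CM sanity values (level 3): `Φ₃(0, 0) = Φ₃(54000, 54000) = Φ₃(−32768, −32768) = 0`,
`Φ₃(0, −12288000) = 0` (`−12288000 = j(ℤ[3(1+√−3)/2])`). -/
theorem Phi3_cm_values (P : ℤ → ℤ → ℤ)
    (hP : ∀ x y, P x y = x ^ 4 + y ^ 4 - x ^ 3 * y ^ 3 + 2232 * (x ^ 3 * y ^ 2 + x ^ 2 * y ^ 3)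
        - 1069956 * (x ^ 3 * y + x * y ^ 3) + 36864000 * (x ^ 3 + y ^ 3)
        + 2587918086 * x ^ 2 * y ^ 2 + 8900222976000 * (x ^ 2 * y + x * y ^ 2)
        + 452984832000000 * (x ^ 2 + y ^ 2) - 770845966336000000 * x * y
        + 1855425871872000000000 * (x + y)) :
    P 0 0 = 0 ∧ P 54000 54000 = 0 ∧ P (-32768) (-32768) = 0 ∧ P 0 (-12288000) = 0 := by
  simp only [hP]; norm_num

/-- `Φ₂(X, y)` as a cubic in `X`: `X³ + c₂(y) X² + c₁(y) X + c₀(y)`. -/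
theorem Phi2_coeffs (x y : ℤ) :
    x ^ 3 + y ^ 3 - x ^ 2 * y ^ 2 + 1488 * (x ^ 2 * y + x * y ^ 2) - 162000 * (x ^ 2 + y ^ 2)
        + 40773375 * x * y + 8748000000 * (x + y) - 157464000000000
      = x ^ 3 + (-y ^ 2 + 1488 * y - 162000) * x ^ 2
      + (1488 * y ^ 2 + 40773375 * y + 8748000000) * x
      + (y ^ 3 - 162000 * y ^ 2 + 8748000000 * y - 157464000000000) := by
  ring

/-- `2`-adic content of the coefficients of `Φ₂` (variable `θ`): the table `v₂(c_{j,b})` of the derivation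
note — `c₂`: (4, 4, 0), `c₁`: (8, 0, 4), `c₀`: (12, 8, 4, 0) — with the odd cofactors exhibited. -/
theorem Phi2_two_adic :
    (162000 : ℤ) = 2 ^ 4 * 10125 ∧ 10125 % 2 = 1 ∧ (1488 : ℤ) = 2 ^ 4 * 93 ∧ 93 % 2 = 1 ∧
    (40773375 : ℤ) % 2 = 1 ∧ (8748000000 : ℤ) = 2 ^ 8 * 34171875 ∧ 34171875 % 2 = 1 ∧
    (157464000000000 : ℤ) = 2 ^ 12 * 38443359375 ∧ 38443359375 % 2 = 1 ∧ (1728 : ℤ) = 2 ^ 6 * 27 := by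
  norm_num

/-- The shifted level-3 polynomial `Ψ₃(X, Y) = Φ₃(X + 1728, Y + 1728)` as a quartic in `X` with
coefficients polynomial in `y` (variable `ψ = θ − 1728`). -/
theorem Psi3_coeffs (P : ℤ → ℤ → ℤ)
    (hP : ∀ x y, P x y = x ^ 4 + y ^ 4 - x ^ 3 * y ^ 3 + 2232 * (x ^ 3 * y ^ 2 + x ^ 2 * y ^ 3)
        - 1069956 * (x ^ 3 * y + x * y ^ 3) + 36864000 * (x ^ 3 + y ^ 3)
        + 2587918086 * x ^ 2 * y ^ 2 + 8900222976000 * (x ^ 2 * y + x * y ^ 2)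
        + 452984832000000 * (x ^ 2 + y ^ 2) - 770845966336000000 * x * y
        + 1855425871872000000000 * (x + y)) (x y : ℤ) :
    P (x + 1728) (y + 1728) =
      x ^ 4
      + (-y ^ 3 - 2952 * y ^ 2 - 2314116 * y - 307077120) * x ^ 3
      + (-2952 * y ^ 3 + 2584185606 * y ^ 2 + 17852065652736 * y + 23569976856674304) * x ^ 2
      + (-2314116 * y ^ 3 + 17852065652736 * y ^ 2 - 678378911709528064 * y
          + 631435035527620853760) * x
      + (y ^ 4 - 307077120 * y ^ 3 + 23569976856674304 * y ^ 2 + 631435035527620853760 * y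
          + 4228267285432392329723904) := by
  rw [hP]; ring

/-- `3`-adic content of the coefficients of `Ψ₃` (the table `v₃(a_{j,b})` of the derivation note:
`c₃`: `b = 0..3 ↦ 2, 3, 2, 0`; `c₂`: `3, 5, 4, 2`; `c₁`: `5, 0, 5, 3`; `c₀`: `b = 0..4 ↦ 6, 5, 3, 2, 0`),
each coefficient written as `3^v · m` with `3 ∤ m`; and `1728 = 3³ · 64`. -/
theorem Psi3_three_adic :
    (2952 : ℤ) = 3 ^ 2 * 328 ∧ (328 : ℤ) % 3 ≠ 0 ∧
    (2314116 : ℤ) = 3 ^ 3 * 85708 ∧ (85708 : ℤ) % 3 ≠ 0 ∧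
    (307077120 : ℤ) = 3 ^ 2 * 34119680 ∧ (34119680 : ℤ) % 3 ≠ 0 ∧
    (2584185606 : ℤ) = 3 ^ 4 * 31903526 ∧ (31903526 : ℤ) % 3 ≠ 0 ∧
    (17852065652736 : ℤ) = 3 ^ 5 * 73465290752 ∧ (73465290752 : ℤ) % 3 ≠ 0 ∧
    (23569976856674304 : ℤ) = 3 ^ 3 * 872962105802752 ∧ (872962105802752 : ℤ) % 3 ≠ 0 ∧
    (678378911709528064 : ℤ) % 3 ≠ 0 ∧
    (631435035527620853760 : ℤ) = 3 ^ 5 * 2598498088591032320 ∧ (2598498088591032320 : ℤ) % 3 ≠ 0 ∧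
    (4228267285432392329723904 : ℤ) = 3 ^ 6 * 5800092298261169176576 ∧
    (5800092298261169176576 : ℤ) % 3 ≠ 0 ∧ (1728 : ℤ) = 3 ^ 3 * 64 := by
  norm_num

end IntegerFacts

end Summit.HodgeConjecture.HodgeConjecture.HodgeLocus.Census.TheoremQC
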